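import Mathlib
import Literature.MathematicalPhysics.QuantumFieldTheory.Balaban1983to89.B6BondElimination

/-!
# Bałaban [B6], (2.123): the tree-gauge Poincaré inequality inside one block — kernel node

T. Bałaban, *Propagators and renormalization transformations for lattice gauge theories. II*,
Comm. Math. Phys. **96** (1984) 223–250 [`Balaban1984PropagatorsII`], p. 244, the first step of the printed
proof of Lemma 2.4 (2.128).  VERBATIM (p. 244): on the configurations B satisfying (2.121)
*"B(b) = 0 for b ⊂ Γ_{y,x}, x ∈ B(y), y ∈ Λ′"* one has

  (2.123)  *"Σ_{b⊂B(y)} |B(b)|² ≤ dL^d Σ_{p⊂B(y)} |(∂₁B)(p)|²."*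

with the printed derivation (p. 244): *"For b = ⟨x, x + e₂⟩, we have B(x, x + e₂) = (B(x, x + e₂) − B(x − e₁,
x − e₁ + e₂)) + … + (B((y₁ + 1, x₂, …, x_d), (y₁ + 1, x₂ + 1, …, x_d)) − B((y₁, x₂, …, x_d), (y₁, x₂ + 1, …,
x_d))) = Σ (∂₁B)(p(x′)), the sum is over the plaquettes p(x′) determined by the points x′ ∈ [(y₁, x₂, …, x_d), x]
and vectors e₁, e₂, so |B(x, x + e₂)|² ≤ |x₁ − y₁| Σ |(∂₁B)(p(x′))|². … For arbitrary j, 2 ≤ j ≤ d, we have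
|B(x, x + e_j)|² ≤ (|x₁ − y₁| + … + |x_{j−1} − y_{j−1}|) Σ |(∂₁B)(p(x′))|², the sum is over x′ ∈ [(y₁, …, y_{j−1},
x_j, …, x_d), (y₁, …, x_{j−1}, x_j, …, x_d) [∪ … ∪[(y₁, x₂, …, x_d), x] [sic: the bracket closing the first interval
is PRINTED as an opening bracket; read (y₁, …, x_{j−1}, x_j, …, x_d)] ∪ … ∪ [(y₁, x₂, …, x_d), x] — editorial note of
the audit, not part of the quotation] and the plaquettes p(x′) are parallel to
(e_{j−1}, e_j), …, (e₁, e_j).  We sum the above inequalities over x and j = 2, …, d.  The sum over j involves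
disjoint sets of plaquettes on the right-hand side, so to get a constant in the inequality we have to consider
the sum over x.  The worst situation is for j = d and it is easy to see that Σ_{x:⟨x,x+e_d⟩⊂B(y)} |B(x, x + e_d)|²
≤ (d − 1)(L − 1)² L^{d−2} Σ′_d |(∂₁B)(p)|², hence"* (2.123).

## What this module does

It PROVES (2.123) in the kernel, on the concrete unit-lattice carrier already used by `B6BondElimination`
(sites `Fin d → ℤ`, unit bonds `(Fin d → ℤ) × Fin d` = ⟨z, z + e_μ⟩, blocks `B6Elimination.block L y` = B5 (1.6),
tree bonds `B6BondElimination.treeBonds L y` = the bonds of the contours Γ_{y,x}, x ∈ B(y), of B5 (1.7), whose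
fidelity to the print is `B6BondElimination.isTree_iff` / `axial_iff`), following the printed derivation line by
line: the telescoping of B(x, x + e_μ) along the comb (y₁, …, y_{j−1}, ·, x_{j+1}, …), j < μ, into plaquette
derivatives (§2, `bond_eq_sum_curl`), Cauchy–Schwarz (§3), the plaquette multiplicity count behind *"it is easy to
see that"* (§4, `multiplicity_le`: each plaquette parallel to (e_j, e_μ) is used by at most (L − 1)L^j ≤ (L − 1)L^{d−2}
bonds of direction μ, by an explicit injection), and the assembly (§5): the printed intermediate constant
`ineq2123_sharp` (Σ_{b⊂B(y)} |B(b)|² ≤ (d − 1)(L − 1)² L^{d−2} Σ_{p⊂B(y)} |(∂₁B)(p)|²) and (2.123) itself, `ineq2123`,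
plus the form summed over a family of blocks, `ineq2123_sum` (the shape L^{−d} N_in ≤ d P_in in which (2.123) enters
the assembly `B6.lemma24K_of_steps` as the hypothesis `B6.Step2123`).

Conventions (0-indexed directions `Fin d`; the print's e₁, …, e_d are e₀, …, e_{d−1} here): a configuration is ANY
real function on unit bonds, `Cfg d` (its values on bonds not inside B(y) never enter); *"b ⊂ B(y)"* = both end
points of b in B(y) (`innerBonds`, `mem_innerBonds_iff`); a plaquette p ⊂ B(y) is recorded ONCE as (z, j, μ) with
j < μ, z its lowest corner and all four corners z, z + e_j, z + e_μ, z + e_j + e_μ in B(y) (`innerPlaq`,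
`mem_innerPlaq_iff`); (∂₁B)(p) is the lattice exterior derivative (circulation) `curl B z j μ = B⟨z, z+e_j⟩ +
B⟨z+e_j, z+e_j+e_μ⟩ − B⟨z+e_μ, z+e_μ+e_j⟩ − B⟨z, z+e_μ⟩` (B5 (1.4): the plaquette variable of a 1-form; its sign /
orientation is immaterial since only |(∂₁B)(p)|² enters).  The tree gauge (2.121) for the block B(y) is the
hypothesis `∀ b ∈ treeBonds L y, B b = 0`.

STATUS: (2.123) — PROVED here (`ineq2123`), together with the printed intermediate bound (`ineq2123_sharp`); no
cited input, no hypothesis beyond the printed tree gauge (2.121) on the block.  v1.1 (DOCFIX, referee cross-read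
REFEREE5.md #70 / GAPS C-ref5-70): the p. 244 quotation above now reproduces the printed bracket glyph with a [sic]
note instead of correcting it silently; docstrings only, every declaration unchanged.  This is the first kernel-checked
step of Lemma 2.4; the remaining printed steps (2.124)–(2.127) are NOT touched here ((2.127) as printed is false
for L ≥ 10, `B6.ineq2127_fails_L10`; the assembly of Lemma 2.4 from its steps is `B6.lemma24K_of_steps`).
-/

open Finset

namespace Literature.MathematicalPhysics.QuantumFieldTheory.Balaban1983to89.B6TreeGaugePoincare

open B6Elimination (block mem_block)
open B6BondElimination (unitVec unitVec_apply add_unitVec_apply treeBonds mem_treeBonds)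

noncomputable section

variable {d : ℕ} {L : ℕ}

/-! ## §1  Configurations, inner bonds, inner plaquettes, the plaquette derivative -/

/-- A configuration on the unit bonds of ℤ^d: `B (z, μ)` = B(⟨z, z + e_μ⟩) (B5 p. 18: a 1-form on the unit
lattice; only its values on the bonds inside the block under consideration enter below). [folklore] -/
abbrev Cfg (d : ℕ) : Type := (Fin d → ℤ) × Fin d → ℝ

/-- (∂₁B)(p) for the plaquette p with lowest corner z spanned by (e_j, e_μ): the circulation
B⟨z, z+e_j⟩ + B⟨z+e_j, z+e_j+e_μ⟩ − B⟨z+e_μ, z+e_μ+e_j⟩ − B⟨z, z+e_μ⟩ (B5 (1.4), the plaquette variable of the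
1-form B; B6 p. 244 *"(∂₁B)(p(x′)) … the plaquettes p(x′) determined by the points x′ … and vectors e₁, e₂"*).
[cite: Balaban1984PropagatorsI, (1.4) p.18] -/
def curl (B : Cfg d) (z : Fin d → ℤ) (j μ : Fin d) : ℝ :=
  B (z, j) + B (z + unitVec j, μ) - B (z + unitVec μ, j) - B (z, μ)

/-- The bonds b ⊂ B(y) of (2.123): unit bonds ⟨z, z + e_μ⟩ with both end points in the block B(y), i.e.
z ∈ B(y) and z_μ + 1 < y_μ + L. [cite: Balaban1984PropagatorsII, (2.123) p.244] -/
def innerBonds (L : ℕ) (y : Fin d → ℤ) : Finset ((Fin d → ℤ) × Fin d) :=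
  (block L y ×ˢ (univ : Finset (Fin d))).filter fun b => b.1 b.2 + 1 < y b.2 + L

/-- Membership in the inner bonds, coordinate form. [folklore] -/
theorem mem_innerBonds {y : Fin d → ℤ} {b : (Fin d → ℤ) × Fin d} :
    b ∈ innerBonds L y ↔ b.1 ∈ block L y ∧ b.1 b.2 + 1 < y b.2 + L := by
  simp only [innerBonds, mem_filter, mem_product, mem_univ, and_true]

/-- Fidelity: b = ⟨z, z + e_μ⟩ ⊂ B(y) iff both end points lie in B(y). [folklore] -/
theorem mem_innerBonds_iff {y : Fin d → ℤ} {b : (Fin d → ℤ) × Fin d} :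
    b ∈ innerBonds L y ↔ b.1 ∈ block L y ∧ b.1 + unitVec b.2 ∈ block L y := by
  rw [mem_innerBonds]
  constructor
  · rintro ⟨hz, hμ⟩
    refine ⟨hz, mem_block.2 fun i => ?_⟩
    have hi := mem_block.1 hz i
    rw [add_unitVec_apply]
    split_ifs with h
    · subst h; omega
    · omega
  · rintro ⟨hz, hz'⟩
    refine ⟨hz, ?_⟩
    have := (mem_block.1 hz' b.2).2
    rw [add_unitVec_apply, if_pos rfl] at this
    exact this

/-- The tree bonds of B(y) are bonds inside B(y). [folklore] -/
theorem treeBonds_subset_innerBonds (y : Fin d → ℤ) : treeBonds L y ⊆ innerBonds L y := fun b hb => by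
  obtain ⟨hz, -, hμ⟩ := mem_treeBonds.1 hb
  exact mem_innerBonds.2 ⟨hz, hμ⟩

/-- The plaquettes p ⊂ B(y) of (2.123), each recorded once as (z, j, μ): lowest corner z ∈ B(y), directions
j < μ, and z_j + 1 < y_j + L, z_μ + 1 < y_μ + L (all four corners in B(y), `mem_innerPlaq_iff`).
[cite: Balaban1984PropagatorsII, (2.123) p.244] -/
def innerPlaq (L : ℕ) (y : Fin d → ℤ) : Finset ((Fin d → ℤ) × Fin d × Fin d) :=
  (block L y ×ˢ ((univ : Finset (Fin d)) ×ˢ (univ : Finset (Fin d)))).filter fun p =>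
    p.2.1 < p.2.2 ∧ p.1 p.2.1 + 1 < y p.2.1 + L ∧ p.1 p.2.2 + 1 < y p.2.2 + L

/-- Membership in the inner plaquettes, coordinate form. [folklore] -/
theorem mem_innerPlaq {y : Fin d → ℤ} {p : (Fin d → ℤ) × Fin d × Fin d} :
    p ∈ innerPlaq L y ↔
      p.1 ∈ block L y ∧ p.2.1 < p.2.2 ∧ p.1 p.2.1 + 1 < y p.2.1 + L ∧ p.1 p.2.2 + 1 < y p.2.2 + L := by
  simp only [innerPlaq, mem_filter, mem_product, mem_univ, and_true]

/-- One step in direction ν stays in B(y) iff the ν-th coordinate does. [folklore] -/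
theorem add_unitVec_mem_block_iff {y w : Fin d → ℤ} (hw : w ∈ block L y) (ν : Fin d) :
    w + unitVec ν ∈ block L y ↔ w ν + 1 < y ν + L := by
  have hb := mem_block.1 hw
  constructor
  · intro h
    have := (mem_block.1 h ν).2
    rw [add_unitVec_apply, if_pos rfl] at this
    exact this
  · intro h
    refine mem_block.2 fun i => ?_
    rw [add_unitVec_apply]
    split_ifs with h1
    · have h2 := hb i
      subst h1
      omega
    · have := hb i
      omega

/-- Fidelity: (z, j, μ) is an inner plaquette iff j < μ and its four corners z, z + e_j, z + e_μ, z + e_j + e_μ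
lie in B(y). [folklore] -/
theorem mem_innerPlaq_iff {y : Fin d → ℤ} {z : Fin d → ℤ} {j μ : Fin d} :
    (z, j, μ) ∈ innerPlaq L y ↔
      j < μ ∧ z ∈ block L y ∧ z + unitVec j ∈ block L y ∧ z + unitVec μ ∈ block L y ∧
        z + unitVec j + unitVec μ ∈ block L y := by
  simp only [mem_innerPlaq]
  constructor
  · rintro ⟨hz, hjμ, hj, hμ⟩
    have hzj : z + unitVec j ∈ block L y := (add_unitVec_mem_block_iff hz j).2 hj
    refine ⟨hjμ, hz, hzj, (add_unitVec_mem_block_iff hz μ).2 hμ, (add_unitVec_mem_block_iff hzj μ).2 ?_⟩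
    rw [add_unitVec_apply, if_neg (ne_of_gt hjμ), add_zero]
    exact hμ
  · rintro ⟨hjμ, hz, hzj, hzμ, -⟩
    exact ⟨hz, hjμ, (add_unitVec_mem_block_iff hz j).1 hzj, (add_unitVec_mem_block_iff hz μ).1 hzμ⟩

/-! ## §2  The printed telescoping along the comb: B(x, x + e_μ) = Σ (∂₁B)(p(x′)) -/

/-- The corner points of the comb from x to the tree: `comb y x k` has the coordinates i < k of y and the
coordinates i ≥ k of x (the print's (y₁, …, y_k, x_{k+1}, …, x_d); `comb y x 0 = x`). [folklore] -/
def comb (y x : Fin d → ℤ) (k : ℕ) : Fin d → ℤ := fun i => if (i : ℕ) < k then y i else x i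

/-- The points x′ of the segment of direction j of the comb: coordinates i < j from y, coordinate j equal to
t, coordinates i > j from x (the print's x′ ∈ [(y₁, …, y_{j−1}, y_j, x_{j+1}, …), (y₁, …, y_{j−1}, x_j, x_{j+1},
…)]). [folklore] -/
def seg (y x : Fin d → ℤ) (j : Fin d) (t : ℤ) : Fin d → ℤ :=
  fun i => if i < j then y i else if i = j then t else x i

/-- The comb starts at x. [folklore] -/
theorem comb_zero (y x : Fin d → ℤ) : comb y x 0 = x := by
  funext i; simp [comb]

/-- The j-th coordinate of a point of the j-th segment. [folklore] -/
theorem seg_apply_self (y x : Fin d → ℤ) (j : Fin d) (t : ℤ) : seg y x j t j = t := by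
  simp [seg]

/-- The coordinates before j of a point of the j-th segment are those of y. [folklore] -/
theorem seg_apply_of_lt (y x : Fin d → ℤ) {j i : Fin d} (h : i < j) (t : ℤ) : seg y x j t i = y i := by
  simp [seg, h]

/-- The coordinates after j of a point of the j-th segment are those of x. [folklore] -/
theorem seg_apply_of_gt (y x : Fin d → ℤ) {j i : Fin d} (h : j < i) (t : ℤ) : seg y x j t i = x i := by
  simp [seg, lt_asymm h, ne_of_gt h]

/-- The top of the j-th segment is the k = j corner of the comb. [folklore] -/
theorem seg_top (y x : Fin d → ℤ) (j : Fin d) : seg y x j (x j) = comb y x j := by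
  funext i
  simp only [seg, comb]
  by_cases h1 : i < j
  · rw [if_pos h1, if_pos (Fin.lt_def.1 h1)]
  · rw [if_neg h1, if_neg (fun h => h1 (Fin.lt_def.2 h))]
    by_cases h2 : i = j
    · rw [if_pos h2, h2]
    · rw [if_neg h2]

/-- The bottom of the j-th segment is the k = j + 1 corner of the comb. [folklore] -/
theorem seg_bot (y x : Fin d → ℤ) (j : Fin d) : seg y x j (y j) = comb y x (j + 1) := by
  funext i
  simp only [seg, comb]
  by_cases h1 : i < j
  · rw [if_pos h1, if_pos (by have := Fin.lt_def.1 h1; omega)]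
  · by_cases h2 : i = j
    · subst h2
      rw [if_neg h1, if_pos rfl, if_pos (by omega)]
    · have h3 : j < i := lt_of_le_of_ne (not_lt.1 h1) (Ne.symm h2)
      rw [if_neg h1, if_neg h2, if_neg (by have := Fin.lt_def.1 h3; omega)]

/-- One step up the segment: x′ + e_j. [folklore] -/
theorem seg_add_unitVec (y x : Fin d → ℤ) (j : Fin d) (t : ℤ) : seg y x j t + unitVec j = seg y x j (t + 1) := by
  funext i
  rw [add_unitVec_apply]
  by_cases h : i = j
  · subst h; simp [seg]
  · simp [seg, h]

/-- The k = μ corner of the comb starts a TREE bond of direction μ (its coordinates before μ are those of y),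
provided ⟨x, x + e_μ⟩ ⊂ B(y). [folklore] -/
theorem comb_mem_treeBonds {y x : Fin d → ℤ} (hx : x ∈ block L y) (μ : Fin d)
    (hμ : x μ + 1 < y μ + L) : (comb y x μ, μ) ∈ treeBonds L y := by
  have hb := mem_block.1 hx
  refine mem_treeBonds.2 ⟨mem_block.2 fun i => ?_, fun i hi => ?_, ?_⟩ <;> dsimp only
  · simp only [comb]
    split_ifs
    · constructor <;> [rfl; (have := hb i; omega)]
    · exact hb i
  · simp only [comb, Fin.lt_def] at hi ⊢; rw [if_pos hi]
  · simp only [comb, lt_irrefl, if_false]; exact hμ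

/-- The direction-j bond at a segment point x′ (coordinates before j equal to y's) is a tree bond.
[folklore] -/
theorem seg_mem_treeBonds {y x : Fin d → ℤ} (hx : x ∈ block L y) (j : Fin d) {t : ℤ}
    (ht : y j ≤ t) (ht' : t + 1 < y j + L) : (seg y x j t, j) ∈ treeBonds L y := by
  have hb := mem_block.1 hx
  refine mem_treeBonds.2 ⟨mem_block.2 fun i => ?_, fun i hi => ?_, ?_⟩ <;> dsimp only
  · by_cases h1 : i < j
    · rw [seg_apply_of_lt _ _ h1]; constructor <;> [rfl; (have := hb i; omega)]
    · by_cases h2 : i = j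
      · subst h2; rw [seg_apply_self]; omega
      · rw [seg_apply_of_gt _ _ (lt_of_le_of_ne (not_lt.1 h1) (Ne.symm h2))]; exact hb i
  · exact seg_apply_of_lt _ _ hi _
  · simp only [seg_apply_self]; exact ht'

/-- The direction-j bond at x′ + e_μ, j < μ, is a tree bond as well when ⟨x, x + e_μ⟩ ⊂ B(y). [folklore] -/
theorem seg_add_mem_treeBonds {y x : Fin d → ℤ} (hx : x ∈ block L y) {j μ : Fin d} (hjμ : j < μ)
    (hμ : x μ + 1 < y μ + L) {t : ℤ} (ht : y j ≤ t) (ht' : t + 1 < y j + L) :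
    (seg y x j t + unitVec μ, j) ∈ treeBonds L y := by
  have hb := mem_block.1 hx
  have hjne : j ≠ μ := ne_of_lt hjμ
  refine mem_treeBonds.2 ⟨mem_block.2 fun i => ?_, fun i hi => ?_, ?_⟩ <;> dsimp only
  · rw [add_unitVec_apply]
    by_cases h1 : i < j
    · rw [seg_apply_of_lt _ _ h1, if_neg (ne_of_lt (lt_trans h1 hjμ))]
      constructor <;> [simp; (have := hb i; omega)]
    · by_cases h2 : i = j
      · subst h2; rw [seg_apply_self, if_neg hjne]; omega
      · rw [seg_apply_of_gt _ _ (lt_of_le_of_ne (not_lt.1 h1) (Ne.symm h2))]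
        have := hb i
        split_ifs with h3
        · subst h3; omega
        · omega
  · rw [add_unitVec_apply, seg_apply_of_lt _ _ hi, if_neg (ne_of_lt (lt_trans hi hjμ)), add_zero]
  · rw [add_unitVec_apply, seg_apply_self, if_neg hjne, add_zero]; exact ht'

/-- One plaquette: in the tree gauge, B(x′ + e_j, ·+e_μ) − B(x′, ·+e_μ) = (∂₁B)(p(x′)) for the plaquette at x′
parallel to (e_j, e_μ) — the two direction-j sides of p(x′) are tree bonds. [cite: Balaban1984PropagatorsII, p.244] -/
theorem step_eq_curl {y x : Fin d → ℤ} (hx : x ∈ block L y) {j μ : Fin d} (hjμ : j < μ)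
    (hμ : x μ + 1 < y μ + L) (B : Cfg d) (hB : ∀ b ∈ treeBonds L y, B b = 0) {t : ℤ} (ht : y j ≤ t)
    (ht' : t + 1 < y j + L) :
    B (seg y x j (t + 1), μ) - B (seg y x j t, μ) = curl B (seg y x j t) j μ := by
  rw [curl, hB _ (seg_mem_treeBonds hx j ht ht'), hB _ (seg_add_mem_treeBonds hx hjμ hμ ht ht'),
    seg_add_unitVec]
  ring

/-- The plaquette derivatives met on the j-th segment of the comb of x, as a function of s = x′_j − y_j.
[folklore] -/
def segCurl (B : Cfg d) (y x : Fin d → ℤ) (j μ : Fin d) (s : ℕ) : ℝ := curl B (seg y x j (y j + s)) j μ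

/-- One segment: B((y_{<j}, x_j, x_{>j}), ·+e_μ) − B((y_{<j}, y_j, x_{>j}), ·+e_μ) = Σ_{s < x_j − y_j} (∂₁B)(p(x′_s)),
x′_s = (y_{<j}, y_j + s, x_{>j}). [cite: Balaban1984PropagatorsII, p.244] -/
theorem segment_eq_sum {y x : Fin d → ℤ} (hx : x ∈ block L y) {j μ : Fin d} (hjμ : j < μ)
    (hμ : x μ + 1 < y μ + L) (B : Cfg d) (hB : ∀ b ∈ treeBonds L y, B b = 0) :
    B (comb y x j, μ) - B (comb y x (j + 1), μ) =
      ∑ s ∈ range (x j - y j).toNat, segCurl B y x j μ s := by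
  have hb := mem_block.1 hx j
  have hn : y j + ((x j - y j).toNat : ℕ) = x j := by
    rw [Int.toNat_of_nonneg (by omega)]; ring
  have key : ∀ s ∈ range (x j - y j).toNat,
      segCurl B y x j μ s = B (seg y x j (y j + (s + 1 : ℕ)), μ) - B (seg y x j (y j + s), μ) := by
    intro s hs
    rw [mem_range] at hs
    have hs' : (s : ℤ) < x j - y j := by
      have := Int.toNat_of_nonneg (show 0 ≤ x j - y j by omega); omega
    rw [segCurl, ← step_eq_curl hx hjμ hμ B hB (by omega) (by omega)]
    push_cast
    ring_nf
  rw [sum_congr rfl key, sum_range_sub (fun s : ℕ => B (seg y x j (y j + s), μ)), hn, seg_top]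
  simp only [Nat.cast_zero, add_zero, seg_bot]

/-- The comb telescoping, k steps: B(x, x + e_μ) = B(comb_k, comb_k + e_μ) + Σ_{j<k} (segment sums), k ≤ μ.
[folklore] -/
theorem bond_eq_comb_add_sum {y x : Fin d → ℤ} (hx : x ∈ block L y) (μ : Fin d)
    (hμ : x μ + 1 < y μ + L) (B : Cfg d) (hB : ∀ b ∈ treeBonds L y, B b = 0) (k : ℕ) (hk : k ≤ μ) :
    B (x, μ) = B (comb y x k, μ) +
      ∑ j ∈ univ.filter (fun j : Fin d => (j : ℕ) < k), ∑ s ∈ range (x j - y j).toNat, segCurl B y x j μ s := by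
  induction k with
  | zero => simp [comb_zero]
  | succ k ih =>
    have hkd : k < d := lt_of_lt_of_le (Nat.lt_of_succ_le hk) μ.2.le
    set j₀ : Fin d := ⟨k, hkd⟩ with hj₀
    have hj₀μ : j₀ < μ := Fin.lt_def.2 (Nat.lt_of_succ_le hk)
    have hfilt : univ.filter (fun j : Fin d => (j : ℕ) < k + 1) =
        insert j₀ (univ.filter (fun j : Fin d => (j : ℕ) < k)) := by
      ext j
      simp only [mem_filter, mem_univ, true_and, mem_insert, Fin.ext_iff, hj₀]
      omega
    have hnot : j₀ ∉ univ.filter (fun j : Fin d => (j : ℕ) < k) := by simp [hj₀]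
    rw [ih (Nat.le_of_succ_le hk), hfilt, sum_insert hnot, ← segment_eq_sum hx hj₀μ hμ B hB]
    simp only [hj₀]
    ring

/-- B6 p. 244, the telescoping identity: for ⟨x, x + e_μ⟩ ⊂ B(y) in the tree gauge,
B(x, x + e_μ) = Σ_{j<μ} Σ_{x′ on the j-th segment} (∂₁B)(p(x′)). [cite: Balaban1984PropagatorsII, p.244] -/
theorem bond_eq_sum_curl {y x : Fin d → ℤ} (hx : x ∈ block L y) (μ : Fin d)
    (hμ : x μ + 1 < y μ + L) (B : Cfg d) (hB : ∀ b ∈ treeBonds L y, B b = 0) :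
    B (x, μ) = ∑ j ∈ univ.filter (· < μ), ∑ s ∈ range (x j - y j).toNat, segCurl B y x j μ s := by
  have h := bond_eq_comb_add_sum hx μ hμ B hB μ le_rfl
  rw [hB _ (comb_mem_treeBonds hx μ hμ), zero_add] at h
  convert h using 2
  ext j
  simp only [mem_filter, mem_univ, true_and, Fin.lt_def]

/-! ## §3  Cauchy–Schwarz per bond: |B(x, x + e_μ)|² ≤ (|x₁ − y₁| + … ) Σ |(∂₁B)(p(x′))|² -/

/-- There are at most d − 1 directions j < μ. [folklore] -/
theorem card_filter_lt_le (μ : Fin d) : #(univ.filter fun j : Fin d => j < μ) ≤ d - 1 := by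
  calc #(univ.filter fun j : Fin d => j < μ) ≤ #(univ.erase μ) :=
        card_le_card fun j hj => mem_erase.2 ⟨ne_of_lt (mem_filter.1 hj).2, mem_univ _⟩
    _ = d - 1 := by rw [card_erase_of_mem (mem_univ _), card_univ, Fintype.card_fin]

/-- The j-th segment of the comb of x ∈ B(y) has x_j − y_j ≤ L − 1 plaquettes. [folklore] -/
theorem toNat_sub_le {y x : Fin d → ℤ} (hx : x ∈ block L y) (j : Fin d) :
    ((x j - y j).toNat : ℝ) ≤ (L : ℝ) - 1 := by
  have hb := mem_block.1 hx j
  have h : (((x j - y j).toNat : ℕ) : ℤ) = x j - y j := Int.toNat_of_nonneg (by omega)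
  have h' : (((x j - y j).toNat : ℕ) : ℤ) + 1 ≤ (L : ℤ) := by omega
  have h'' : (((x j - y j).toNat : ℕ) : ℝ) + 1 ≤ (L : ℝ) := by exact_mod_cast h'
  linarith

/-- B6 p. 244: *"|B(x, x + e_j)|² ≤ (|x₁ − y₁| + … + |x_{j−1} − y_{j−1}|) Σ |(∂₁B)(p(x′))|²"*, here with the
segment lengths bounded by L − 1 and the number of segments by d − 1: for ⟨x, x + e_μ⟩ ⊂ B(y) in the tree gauge,
|B(x, x + e_μ)|² ≤ (d − 1)(L − 1) Σ_{j<μ} Σ_{x′} |(∂₁B)(p(x′))|² (Cauchy–Schwarz on `bond_eq_sum_curl`).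
[cite: Balaban1984PropagatorsII, p.244] -/
theorem bond_sq_le {y x : Fin d → ℤ} (hx : x ∈ block L y) (μ : Fin d) (hμ : x μ + 1 < y μ + L) (B : Cfg d)
    (hB : ∀ b ∈ treeBonds L y, B b = 0) :
    B (x, μ) ^ 2 ≤ ((d : ℝ) - 1) * ((L : ℝ) - 1) *
      ∑ j ∈ univ.filter (· < μ), ∑ s ∈ range (x j - y j).toNat, segCurl B y x j μ s ^ 2 := by
  rw [bond_eq_sum_curl hx μ hμ B hB]
  set J := univ.filter (fun j : Fin d => j < μ) with hJ
  have hd : 1 ≤ d := Nat.succ_le_of_lt (lt_of_le_of_lt (Nat.zero_le _) μ.2)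
  have hJc : (#J : ℝ) ≤ (d : ℝ) - 1 := by
    have h1 : (#J : ℝ) ≤ ((d - 1 : ℕ) : ℝ) := by exact_mod_cast card_filter_lt_le μ
    rwa [Nat.cast_sub hd, Nat.cast_one] at h1
  have hd' : (0 : ℝ) ≤ (d : ℝ) - 1 := le_trans (Nat.cast_nonneg _) hJc
  have h1 : (∑ j ∈ J, ∑ s ∈ range (x j - y j).toNat, segCurl B y x j μ s) ^ 2 ≤
      #J * ∑ j ∈ J, (∑ s ∈ range (x j - y j).toNat, segCurl B y x j μ s) ^ 2 := sq_sum_le_card_mul_sum_sq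
  have h2 : ∀ j ∈ J, (∑ s ∈ range (x j - y j).toNat, segCurl B y x j μ s) ^ 2 ≤
      ((L : ℝ) - 1) * ∑ s ∈ range (x j - y j).toNat, segCurl B y x j μ s ^ 2 := by
    intro j _
    refine le_trans sq_sum_le_card_mul_sum_sq ?_
    rw [card_range]
    exact mul_le_mul_of_nonneg_right (toNat_sub_le hx j) (sum_nonneg fun _ _ => sq_nonneg _)
  calc (∑ j ∈ J, ∑ s ∈ range (x j - y j).toNat, segCurl B y x j μ s) ^ 2
        ≤ #J * ∑ j ∈ J, (∑ s ∈ range (x j - y j).toNat, segCurl B y x j μ s) ^ 2 := h1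
    _ ≤ ((d : ℝ) - 1) * ∑ j ∈ J, (((L : ℝ) - 1) * ∑ s ∈ range (x j - y j).toNat, segCurl B y x j μ s ^ 2) :=
        mul_le_mul hJc (sum_le_sum h2) (sum_nonneg fun _ _ => sq_nonneg _) hd'
    _ = _ := by rw [← mul_sum]; ring

/-! ## §4  The plaquette multiplicity: *"it is easy to see that"* -/

/-- The starting points x of the bonds ⟨x, x + e_μ⟩ ⊂ B(y) of direction μ. [folklore] -/
def bondStarts (L : ℕ) (y : Fin d → ℤ) (μ : Fin d) : Finset (Fin d → ℤ) :=
  (block L y).filter fun x => x μ + 1 < y μ + L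

/-- The lowest corners z of the plaquettes p ⊂ B(y) parallel to (e_j, e_μ). [folklore] -/
def plaqStarts (L : ℕ) (y : Fin d → ℤ) (j μ : Fin d) : Finset (Fin d → ℤ) :=
  (block L y).filter fun z => z j + 1 < y j + L ∧ z μ + 1 < y μ + L

/-- Membership in `bondStarts`. [folklore] -/
theorem mem_bondStarts {y x : Fin d → ℤ} {μ : Fin d} :
    x ∈ bondStarts L y μ ↔ x ∈ block L y ∧ x μ + 1 < y μ + L := by
  simp only [bondStarts, mem_filter]

/-- Membership in `plaqStarts`. [folklore] -/
theorem mem_plaqStarts {y z : Fin d → ℤ} {j μ : Fin d} :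
    z ∈ plaqStarts L y j μ ↔ z ∈ block L y ∧ z j + 1 < y j + L ∧ z μ + 1 < y μ + L := by
  simp only [plaqStarts, mem_filter]

/-- "The plaquette at z (parallel to (e_j, e_μ)) lies on the j-th segment of the comb of x": the coordinates
after j of z are those of x and z_j < x_j. [folklore] -/
def OnSeg (j : Fin d) (x z : Fin d → ℤ) : Prop := (∀ i, j < i → z i = x i) ∧ z j < x j

/-- `OnSeg` is decidable (finitely many integer (in)equalities). [folklore] -/
instance (j : Fin d) (x z : Fin d → ℤ) : Decidable (OnSeg j x z) := by
  unfold OnSeg; infer_instance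

/-- The plaquettes met on the j-th segment of the comb of x, as a sum over plaquette corners with the
indicator of `OnSeg`. [folklore] -/
theorem sum_seg_le_indicator {y x : Fin d → ℤ} (hx : x ∈ block L y) {j μ : Fin d} (hjμ : j < μ)
    (hμ : x μ + 1 < y μ + L) (F : (Fin d → ℤ) → ℝ) (hF : ∀ z, 0 ≤ F z) :
    ∑ s ∈ range (x j - y j).toNat, F (seg y x j (y j + s)) ≤
      ∑ z ∈ plaqStarts L y j μ, if OnSeg j x z then F z else 0 := by
  classical
  have hb := mem_block.1 hx
  have hn : (((x j - y j).toNat : ℕ) : ℤ) = x j - y j := Int.toNat_of_nonneg (by have := hb j; omega)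
  set φ : ℕ → (Fin d → ℤ) := fun s => seg y x j (y j + s) with hφ
  have hinj : Set.InjOn φ ↑(range (x j - y j).toNat) := by
    intro s _ s' _ h
    have := congr_fun h j
    simp only [hφ, seg_apply_self] at this
    exact_mod_cast (by omega : (s : ℤ) = s')
  rw [← sum_image hinj, ← sum_filter]
  refine sum_le_sum_of_subset_of_nonneg (fun z hz => ?_) fun z _ _ => hF z
  obtain ⟨s, hs, rfl⟩ := mem_image.1 hz
  simp only [mem_range] at hs
  have hs' : (s : ℤ) < x j - y j := by omega
  have hbj := hb j
  have hmem := (mem_treeBonds.1 (seg_mem_treeBonds hx j (t := y j + s) (by omega) (by omega))).1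
  refine mem_filter.2 ⟨mem_plaqStarts.2 ⟨hmem, ?_, ?_⟩, fun i hi => ?_, ?_⟩
  · simp only [hφ, seg_apply_self]; omega
  · simp only [hφ, seg_apply_of_gt _ _ hjμ]; exact hμ
  · simp only [hφ, seg_apply_of_gt _ _ hi]
  · simp only [hφ, seg_apply_self]; omega

/-- The count behind *"it is easy to see that"*: a plaquette parallel to (e_j, e_μ) with lowest corner z lies on
the j-th comb segment of at most (L − 1)L^j bonds ⟨x, x + e_μ⟩ ⊂ B(y) — x is determined by z up to its
coordinates before j (L choices each) and its j-th coordinate x_j ∈ (z_j, y_j + L − 1] (at most L − 1 choices);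
by an explicit injection into (Fin j → range L) × range (L − 1). [cite: Balaban1984PropagatorsII, p.244] -/
theorem card_onSeg_le {y z : Fin d → ℤ} (hz : z ∈ block L y) (j μ : Fin d) :
    #((bondStarts L y μ).filter fun x => OnSeg j x z) ≤ (L - 1) * L ^ (j : ℕ) := by
  classical
  have hzb := mem_block.1 hz
  set T : Finset ((Fin j → ℕ) × ℕ) :=
    (Fintype.piFinset fun _ : Fin j => range L) ×ˢ range (L - 1) with hT
  have hTc : #T = (L - 1) * L ^ (j : ℕ) := by
    rw [hT, card_product, Fintype.card_piFinset, prod_const, card_univ, Fintype.card_fin, card_range,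
      card_range, mul_comm]
  set ψ : (Fin d → ℤ) → (Fin j → ℕ) × ℕ :=
    fun x => (fun i => (x ⟨i, i.2.trans j.2⟩ - y ⟨i, i.2.trans j.2⟩).toNat, (x j - z j - 1).toNat) with hψ
  rw [← hTc]
  refine card_le_card_of_injOn ψ (fun x hx => ?_) (fun x hx x' hx' h => ?_)
  · rw [mem_coe, mem_filter, mem_bondStarts] at hx
    obtain ⟨⟨hxb, -⟩, -, hlt⟩ := hx
    have hb := mem_block.1 hxb
    rw [hT, mem_coe, mem_product, Fintype.mem_piFinset]
    refine ⟨fun i => mem_range.2 ?_, mem_range.2 ?_⟩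
    · have := hb ⟨i, i.2.trans j.2⟩
      simp only [hψ]
      omega
    · have := hb j
      have := hzb j
      simp only [hψ]
      omega
  · rw [mem_coe, mem_filter, mem_bondStarts] at hx hx'
    obtain ⟨⟨hxb, -⟩, hafter, hlt⟩ := hx
    obtain ⟨⟨hxb', -⟩, hafter', hlt'⟩ := hx'
    have hb := mem_block.1 hxb
    have hb' := mem_block.1 hxb'
    simp only [hψ, Prod.mk.injEq] at h
    obtain ⟨h1, h2⟩ := h
    funext i
    by_cases hi : i < j
    · have := congr_fun h1 ⟨i, Fin.lt_def.1 hi⟩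
      have h3 := hb i
      have h4 := hb' i
      simp only [Fin.eta] at this
      omega
    · by_cases hi' : i = j
      · subst hi'; omega
      · have hji : j < i := lt_of_le_of_ne (not_lt.1 hi) (Ne.symm hi')
        rw [← hafter i hji, ← hafter' i hji]

/-- The multiplicity bound, summed: Σ_{⟨x,x+e_μ⟩⊂B(y)} Σ_{x′ on the j-th segment of the comb of x} F(x′)
≤ (L − 1)L^j Σ_{z : p(z)⊂B(y) parallel to (e_j,e_μ)} F(z) for F ≥ 0. [cite: Balaban1984PropagatorsII, p.244] -/
theorem multiplicity_le {y : Fin d → ℤ} {j μ : Fin d} (hjμ : j < μ) (F : (Fin d → ℤ) → ℝ)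
    (hF : ∀ z, 0 ≤ F z) :
    ∑ x ∈ bondStarts L y μ, ∑ s ∈ range (x j - y j).toNat, F (seg y x j (y j + s)) ≤
      (((L - 1) * L ^ (j : ℕ) : ℕ) : ℝ) * ∑ z ∈ plaqStarts L y j μ, F z := by
  classical
  calc ∑ x ∈ bondStarts L y μ, ∑ s ∈ range (x j - y j).toNat, F (seg y x j (y j + s))
      ≤ ∑ x ∈ bondStarts L y μ, ∑ z ∈ plaqStarts L y j μ, if OnSeg j x z then F z else 0 :=
        sum_le_sum fun x hx =>
          sum_seg_le_indicator (mem_bondStarts.1 hx).1 hjμ (mem_bondStarts.1 hx).2 F hF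
    _ = ∑ z ∈ plaqStarts L y j μ, (#((bondStarts L y μ).filter fun x => OnSeg j x z) : ℝ) * F z := by
        rw [sum_comm]
        refine sum_congr rfl fun z _ => ?_
        rw [← sum_filter, sum_const, nsmul_eq_mul]
    _ ≤ ∑ z ∈ plaqStarts L y j μ, (((L - 1) * L ^ (j : ℕ) : ℕ) : ℝ) * F z :=
        sum_le_sum fun z hz =>
          mul_le_mul_of_nonneg_right (by exact_mod_cast card_onSeg_le (mem_plaqStarts.1 hz).1 j μ) (hF z)
    _ = _ := by rw [mul_sum]

/-! ## §5  Assembly: the printed intermediate bound and (2.123) -/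

/-- Σ_{b⊂B(y)} f(b) as an iterated sum over directions and starting points. [folklore] -/
theorem sum_innerBonds_eq (y : Fin d → ℤ) (f : (Fin d → ℤ) × Fin d → ℝ) :
    ∑ b ∈ innerBonds L y, f b = ∑ μ : Fin d, ∑ x ∈ bondStarts L y μ, f (x, μ) := by
  classical
  rw [innerBonds, sum_filter, sum_product, sum_comm]
  refine sum_congr rfl fun μ _ => ?_
  rw [bondStarts, sum_filter]

/-- Σ_{p⊂B(y)} g(p) as an iterated sum over the direction pairs j < μ and the lowest corners. [folklore] -/
theorem sum_innerPlaq_eq (y : Fin d → ℤ) (g : (Fin d → ℤ) → Fin d → Fin d → ℝ) :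
    ∑ p ∈ innerPlaq L y, g p.1 p.2.1 p.2.2 =
      ∑ μ : Fin d, ∑ j ∈ univ.filter (· < μ), ∑ z ∈ plaqStarts L y j μ, g z j μ := by
  classical
  have lhs : ∑ p ∈ innerPlaq L y, g p.1 p.2.1 p.2.2 = ∑ μ : Fin d, ∑ j : Fin d, ∑ z ∈ block L y,
      if j < μ ∧ z j + 1 < y j + L ∧ z μ + 1 < y μ + L then g z j μ else 0 := by
    rw [innerPlaq, sum_filter, sum_product]
    simp only [sum_product]
    rw [sum_comm]
    refine (sum_congr rfl fun j _ => sum_comm).trans ?_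
    rw [sum_comm]
  have rhs : ∑ μ : Fin d, ∑ j ∈ univ.filter (· < μ), ∑ z ∈ plaqStarts L y j μ, g z j μ =
      ∑ μ : Fin d, ∑ j : Fin d, ∑ z ∈ block L y,
        if j < μ ∧ z j + 1 < y j + L ∧ z μ + 1 < y μ + L then g z j μ else 0 := by
    refine sum_congr rfl fun μ _ => ?_
    rw [sum_filter]
    refine sum_congr rfl fun j _ => ?_
    rw [plaqStarts, sum_filter]
    split_ifs with h
    · exact sum_congr rfl fun z _ => by simp only [h, true_and]
    · exact (sum_eq_zero fun z _ => by simp only [h, false_and, if_false]).symm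
  rw [lhs, rhs]

/-- One direction μ: Σ_{⟨x,x+e_μ⟩⊂B(y)} |B(x, x + e_μ)|² ≤ (d − 1)(L − 1)² L^{d−2} Σ_{j<μ} Σ_{p⊂B(y) ∥ (e_j,e_μ)}
|(∂₁B)(p)|² — the print's *"The worst situation is for j = d and it is easy to see that Σ_{x:⟨x,x+e_d⟩⊂B(y)}
|B(x, x + e_d)|² ≤ (d − 1)(L − 1)² L^{d−2} Σ′_d |(∂₁B)(p)|²"*, for every direction. [cite: Balaban1984PropagatorsII, p.244] -/
theorem dir_sq_le (hL : 1 ≤ L) (y : Fin d → ℤ) (μ : Fin d) (B : Cfg d) (hB : ∀ b ∈ treeBonds L y, B b = 0) :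
    ∑ x ∈ bondStarts L y μ, B (x, μ) ^ 2 ≤ ((d : ℝ) - 1) * ((L : ℝ) - 1) ^ 2 * (L : ℝ) ^ (d - 2) *
      ∑ j ∈ univ.filter (· < μ), ∑ z ∈ plaqStarts L y j μ, curl B z j μ ^ 2 := by
  classical
  set J := univ.filter (fun j : Fin d => j < μ) with hJ
  have hL1 : (1 : ℝ) ≤ L := by exact_mod_cast hL
  have hL' : (0 : ℝ) ≤ (L : ℝ) - 1 := by linarith
  have hd' : (0 : ℝ) ≤ (d : ℝ) - 1 := by
    have hd : 1 ≤ d := Nat.succ_le_of_lt (lt_of_le_of_lt (Nat.zero_le _) μ.2)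
    have : (1 : ℝ) ≤ d := by exact_mod_cast hd
    linarith
  have step1 : ∑ x ∈ bondStarts L y μ, B (x, μ) ^ 2 ≤
      ((d : ℝ) - 1) * ((L : ℝ) - 1) * ∑ j ∈ J, ∑ x ∈ bondStarts L y μ,
        ∑ s ∈ range (x j - y j).toNat, curl B (seg y x j (y j + s)) j μ ^ 2 := by
    calc ∑ x ∈ bondStarts L y μ, B (x, μ) ^ 2
        ≤ ∑ x ∈ bondStarts L y μ, ((d : ℝ) - 1) * ((L : ℝ) - 1) *
            ∑ j ∈ J, ∑ s ∈ range (x j - y j).toNat, segCurl B y x j μ s ^ 2 :=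
          sum_le_sum fun x hx => bond_sq_le (mem_bondStarts.1 hx).1 μ (mem_bondStarts.1 hx).2 B hB
      _ = _ := by rw [← mul_sum, sum_comm]; rfl
  have step2 : ∀ j ∈ J, ∑ x ∈ bondStarts L y μ, ∑ s ∈ range (x j - y j).toNat,
      curl B (seg y x j (y j + s)) j μ ^ 2 ≤
        ((L : ℝ) - 1) * (L : ℝ) ^ (d - 2) * ∑ z ∈ plaqStarts L y j μ, curl B z j μ ^ 2 := by
    intro j hj
    have hjμ : j < μ := (mem_filter.1 hj).2
    refine le_trans (multiplicity_le hjμ (fun z => curl B z j μ ^ 2) fun z => sq_nonneg _) ?_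
    refine mul_le_mul_of_nonneg_right ?_ (sum_nonneg fun _ _ => sq_nonneg _)
    rw [Nat.cast_mul, Nat.cast_pow, Nat.cast_sub hL, Nat.cast_one]
    exact mul_le_mul_of_nonneg_left
      (pow_le_pow_right₀ hL1 (by have := Fin.lt_def.1 hjμ; have := μ.2; omega)) hL'
  calc ∑ x ∈ bondStarts L y μ, B (x, μ) ^ 2 ≤ _ := step1
    _ ≤ ((d : ℝ) - 1) * ((L : ℝ) - 1) *
          ∑ j ∈ J, (((L : ℝ) - 1) * (L : ℝ) ^ (d - 2) * ∑ z ∈ plaqStarts L y j μ, curl B z j μ ^ 2) :=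
        mul_le_mul_of_nonneg_left (sum_le_sum step2) (mul_nonneg hd' hL')
    _ = _ := by rw [← mul_sum]; ring

/-- The printed intermediate bound of p. 244, summed over the directions (the plaquette families for
different (j, μ) are disjoint: *"The sum over j involves disjoint sets of plaquettes"*):
Σ_{b⊂B(y)} |B(b)|² ≤ (d − 1)(L − 1)² L^{d−2} Σ_{p⊂B(y)} |(∂₁B)(p)|², in the tree gauge (2.121) on B(y).
[cite: Balaban1984PropagatorsII, p.244] -/
theorem ineq2123_sharp (hL : 1 ≤ L) (y : Fin d → ℤ) (B : Cfg d) (hB : ∀ b ∈ treeBonds L y, B b = 0) :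
    ∑ b ∈ innerBonds L y, B b ^ 2 ≤ ((d : ℝ) - 1) * ((L : ℝ) - 1) ^ 2 * (L : ℝ) ^ (d - 2) *
      ∑ p ∈ innerPlaq L y, curl B p.1 p.2.1 p.2.2 ^ 2 := by
  rw [sum_innerBonds_eq, sum_innerPlaq_eq y (fun z j μ => curl B z j μ ^ 2), mul_sum]
  exact sum_le_sum fun μ _ => dir_sq_le hL y μ B hB

/-- The printed constant: (d − 1)(L − 1)² L^{d−2} ≤ d L^d (*"hence"* (2.123)). [folklore] -/
theorem coeff_le (hL : 1 ≤ L) :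
    ((d : ℝ) - 1) * ((L : ℝ) - 1) ^ 2 * (L : ℝ) ^ (d - 2) ≤ (d : ℝ) * (L : ℝ) ^ d := by
  have hL1 : (1 : ℝ) ≤ L := by exact_mod_cast hL
  rcases Nat.lt_or_ge d 2 with hd | hd
  · have hd1 : (d : ℝ) - 1 ≤ 0 := by
      have : (d : ℝ) ≤ 1 := by exact_mod_cast (by omega : d ≤ 1)
      linarith
    have hP : (0 : ℝ) ≤ ((L : ℝ) - 1) ^ 2 * (L : ℝ) ^ (d - 2) := by positivity
    have hR : (0 : ℝ) ≤ (d : ℝ) * (L : ℝ) ^ d := by positivity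
    nlinarith
  · obtain ⟨k, rfl⟩ : ∃ k, d = k + 2 := ⟨d - 2, by omega⟩
    rw [show k + 2 - 2 = k from by omega, pow_add]
    push_cast
    have h1 : (k : ℝ) + 2 - 1 ≤ (k : ℝ) + 2 := by linarith
    have h2 : ((L : ℝ) - 1) ^ 2 ≤ (L : ℝ) ^ 2 := by nlinarith
    calc ((k : ℝ) + 2 - 1) * ((L : ℝ) - 1) ^ 2 * (L : ℝ) ^ k
        ≤ ((k : ℝ) + 2) * (L : ℝ) ^ 2 * (L : ℝ) ^ k :=
          mul_le_mul (mul_le_mul h1 h2 (sq_nonneg _) (by positivity)) le_rfl (by positivity)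
            (by positivity)
      _ = ((k : ℝ) + 2) * ((L : ℝ) ^ k * (L : ℝ) ^ 2) := by ring

/-- **B6 (2.123)** (p. 244), PROVED: in the tree gauge (2.121) on the block B(y),
Σ_{b⊂B(y)} |B(b)|² ≤ d L^d Σ_{p⊂B(y)} |(∂₁B)(p)|². [cite: Balaban1984PropagatorsII, (2.123) p.244] -/
theorem ineq2123 (hL : 1 ≤ L) (y : Fin d → ℤ) (B : Cfg d) (hB : ∀ b ∈ treeBonds L y, B b = 0) :
    ∑ b ∈ innerBonds L y, B b ^ 2 ≤
      (d : ℝ) * (L : ℝ) ^ d * ∑ p ∈ innerPlaq L y, curl B p.1 p.2.1 p.2.2 ^ 2 :=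
  le_trans (ineq2123_sharp hL y B hB)
    (mul_le_mul_of_nonneg_right (coeff_le hL) (sum_nonneg fun _ _ => sq_nonneg _))

/-- (2.123) summed over a family Y of blocks, each in its tree gauge ((2.121) for y ∈ Y = Λ′):
Σ_{y∈Y} Σ_{b⊂B(y)} |B(b)|² ≤ d L^d Σ_{y∈Y} Σ_{p⊂B(y)} |(∂₁B)(p)|². [cite: Balaban1984PropagatorsII, (2.123) p.244] -/
theorem ineq2123_sum (hL : 1 ≤ L) (Y : Finset (Fin d → ℤ)) (B : Cfg d)
    (hB : ∀ y ∈ Y, ∀ b ∈ treeBonds L y, B b = 0) :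
    ∑ y ∈ Y, ∑ b ∈ innerBonds L y, B b ^ 2 ≤
      (d : ℝ) * (L : ℝ) ^ d * ∑ y ∈ Y, ∑ p ∈ innerPlaq L y, curl B p.1 p.2.1 p.2.2 ^ 2 := by
  rw [mul_sum]
  exact sum_le_sum fun y hy => ineq2123 hL y B (hB y hy)

/-- The same in the rescaled shape L^{−d} N_in ≤ d P_in in which (2.123) enters the assembly of Lemma 2.4
(`B6.Step2123`, `B6.lemma24K_of_steps`): N_in = Σ_{y∈Y} Σ_{b⊂B(y)} |B(b)|², P_in = Σ_{y∈Y} Σ_{p⊂B(y)} |(∂₁B)(p)|².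
[cite: Balaban1984PropagatorsII, (2.123) p.244] -/
theorem ineq2123_rescaled (hL : 1 ≤ L) (Y : Finset (Fin d → ℤ)) (B : Cfg d)
    (hB : ∀ y ∈ Y, ∀ b ∈ treeBonds L y, B b = 0) :
    ((L : ℝ)⁻¹) ^ d * ∑ y ∈ Y, ∑ b ∈ innerBonds L y, B b ^ 2 ≤
      (d : ℝ) * ∑ y ∈ Y, ∑ p ∈ innerPlaq L y, curl B p.1 p.2.1 p.2.2 ^ 2 := by
  have hL0 : (0 : ℝ) < (L : ℝ) := by exact_mod_cast hL
  have hLd : (0 : ℝ) < ((L : ℝ)⁻¹) ^ d := pow_pos (inv_pos.2 hL0) d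
  have h := mul_le_mul_of_nonneg_left (ineq2123_sum hL Y B hB) hLd.le
  refine le_trans h (le_of_eq ?_)
  rw [← mul_assoc, ← mul_assoc, mul_comm (((L : ℝ)⁻¹) ^ d) (d : ℝ), mul_assoc (d : ℝ), ← mul_pow,
    inv_mul_cancel₀ hL0.ne', one_pow, mul_one]

end

end Literature.MathematicalPhysics.QuantumFieldTheory.Balaban1983to89.B6TreeGaugePoincare
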